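import Summits.KontsevichZagierPeriods.KontsevichZagierPeriods.Theorems.RootDecompWalshStrataVertexChart02

/-!
# Conic descent, gen 6 (L5/L6 general fibrewise vertex chart, band move, edge pull-back for ellipse-type fibres), part 3/3

Declarations `edge_term_abs` … `edge_pullback` of the farm-checked gen-6 monolith; see the module docstring of
`VertexChart01` (part 1) for the overview, the design and the sources. [KontsevichZagier2001 §1.2 rules (2),(3); BCR1998 §2.2; this node gen 5 `sqrtDescent₂_ball`]
-/

noncomputable section

open Literature.NumberTheory.Transcendental
open MeasureTheory Set
open MvPolynomial (aeval X C)
open Literature.ModelTheory.ExponentialFields (IsSemialgebraic isSemialgebraic_univ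
  isSemialgebraic_setOf_eval_pos isSemialgebraic_setOf_eval_lt isSemialgebraic_setOf_eval_le
  isSemialgebraic_setOf_eval_nonneg isSemialgebraic_setOf_eval_eq_zero continuous_aeval_real
  tarski_seidenberg_real_holds)

namespace Summit.KontsevichZagierPeriods.RootDecompWalshStrata.ConicDescent.VertexChart

variable {m : ℚ}
variable {Y₀ H : Polynomial ℚ}

/-- **The `m`-free edge integrand, unsigned form.**  With `v_b = V_m ∘ r`,
`r = (y_b − Y₀)/√H`, `t_b = √H·T_m(v_b)` (`= √D(x, y_b(x))`) and
`N_b = 2H(y_b′ − Y₀′) − (y_b − Y₀)H′`: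
`F(x, v_b(x))·|v_b′(x)| = γ·Hi(x)·t_b(x)·|N_b(x)|/(2H(x)²)`. -/
theorem edge_term_abs (hm : 0 ≤ m) {yb : ℝ → ℝ} {yb' x : ℝ} (hyb : HasDerivAt yb yb' x)
    (hx : 0 < Polynomial.aeval x H)
    (hrx : (m : ℝ) * ((yb x - Polynomial.aeval x Y₀) / vS H x) ^ 2 < 1) (Hi : Polynomial ℚ) (γ : ℚ) :
    vF m Hi γ x (gV m ((yb x - Polynomial.aeval x Y₀) / vS H x)) *
        |deriv (fun s => gV m ((yb s - Polynomial.aeval s Y₀) / vS H s)) x| =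
      (γ : ℝ) * Polynomial.aeval x Hi *
        (vS H x * gT m (gV m ((yb x - Polynomial.aeval x Y₀) / vS H x))) *
        (|2 * Polynomial.aeval x H * (yb' - Polynomial.aeval x (Polynomial.derivative Y₀)) -
            (yb x - Polynomial.aeval x Y₀) * Polynomial.aeval x (Polynomial.derivative H)| /
          (2 * Polynomial.aeval x H ^ 2)) := by
  have hS := vS_pos hx
  have hS2 : vS H x ^ 2 = Polynomial.aeval x H := vS_sq hx.le
  have hw := gW_gV_mul_deriv hm (hasDerivAt_ratio (Y₀ := Y₀) hyb hx) hrx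
  set v := gV m ((yb x - Polynomial.aeval x Y₀) / vS H x) with hv
  have hgW : 0 ≤ gW m v := gW_nonneg hm v
  have hgT : 0 ≤ gT m v := gT_nonneg hm ((m_gV_sq_le hm _).trans hrx.le)
  have habs : gW m v * |deriv (fun s => gV m ((yb s - Polynomial.aeval s Y₀) / vS H s)) x| =
      gT m v * |((yb' - Polynomial.aeval x (Polynomial.derivative Y₀)) * vS H x -
        (yb x - Polynomial.aeval x Y₀) * (Polynomial.aeval x (Polynomial.derivative H) / (2 * vS H x))) /
        vS H x ^ 2| := by
    rw [← abs_of_nonneg hgW, ← abs_mul, hw, abs_mul, abs_of_nonneg hgT]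
  have hH : Polynomial.aeval x H ≠ 0 := hx.ne'
  calc vF m Hi γ x v * |deriv (fun s => gV m ((yb s - Polynomial.aeval s Y₀) / vS H s)) x|
      = (γ : ℝ) * Polynomial.aeval x Hi *
          (gW m v * |deriv (fun s => gV m ((yb s - Polynomial.aeval s Y₀) / vS H s)) x|) := by
        rw [vF]; ring
    _ = (γ : ℝ) * Polynomial.aeval x Hi * (gT m v *
          |((yb' - Polynomial.aeval x (Polynomial.derivative Y₀)) * vS H x -
            (yb x - Polynomial.aeval x Y₀) *
              (Polynomial.aeval x (Polynomial.derivative H) / (2 * vS H x))) / vS H x ^ 2|) := by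
        rw [habs]
    _ = _ := by
        rw [abs_div, abs_of_pos (by positivity : (0:ℝ) < vS H x ^ 2)]
        have hkey : ((yb' - Polynomial.aeval x (Polynomial.derivative Y₀)) * vS H x -
            (yb x - Polynomial.aeval x Y₀) *
              (Polynomial.aeval x (Polynomial.derivative H) / (2 * vS H x))) =
            (2 * Polynomial.aeval x H * (yb' - Polynomial.aeval x (Polynomial.derivative Y₀)) -
              (yb x - Polynomial.aeval x Y₀) * Polynomial.aeval x (Polynomial.derivative H)) /
              (2 * vS H x) := by
          field_simp
          rw [hS2]
          ring
        rw [hkey, abs_div, abs_of_pos (by positivity : (0:ℝ) < 2 * vS H x), ← hS2]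
        field_simp

/-- `x ↦ V_m(r(x))`, `r = (y_b − Y₀)/√H`, is `ℚ`-semialgebraic on `T₀` when `y_b` is and `H > 0`
there. [BCR1998 §2.2] -/
theorem isSemialgebraicFunOn_gV_ratio (m : ℚ) {T₀ : Set (Fin 1 → ℝ)} (hT₀ : IsSemialgebraic ℚ T₀)
    {yb : ℝ → ℝ} (hybs : IsSemialgebraicFunOn ℚ T₀ fun t => yb (t 0))
    (hH : ∀ t ∈ T₀, 0 < Polynomial.aeval (t 0) H) :
    IsSemialgebraicFunOn ℚ T₀ fun t =>
      gV m ((yb (t 0) - Polynomial.aeval (t 0) Y₀) / vS H (t 0)) := by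
  have hY : IsSemialgebraicFunOn ℚ T₀ fun t => Polynomial.aeval (t 0) Y₀ :=
    (isSemialgebraicFunOn_aeval hT₀ (Polynomial.aeval (X 0) Y₀)).congr fun t _ => by
      simp only [aeval_polyX₁]
  have hS : IsSemialgebraicFunOn ℚ T₀ fun t => vS H (t 0) :=
    (IsSemialgebraicFunOn.sqrt_holds (isSemialgebraicFunOn_aeval hT₀ (Polynomial.aeval (X 0) H))).congr
      fun t _ => by simp only [aeval_polyX₁, vS]
  have hr : IsSemialgebraicFunOn ℚ T₀ fun t => (yb (t 0) - Polynomial.aeval (t 0) Y₀) / vS H (t 0) :=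
    ((hybs.sub_holds hY).div hS fun t ht => (vS_pos (hH t ht)).ne').congr fun t _ => by
      simp only [Pi.sub_apply]
  have hin : IsSemialgebraicFunOn ℚ T₀ fun t =>
      1 - (m : ℝ) * ((yb (t 0) - Polynomial.aeval (t 0) Y₀) / vS H (t 0)) ^ 2 :=
    ((isSemialgebraicFunOn_ratCast hT₀ 1).sub_holds
      ((isSemialgebraicFunOn_ratCast hT₀ m).mul_holds (hr.mul_holds hr))).congr fun t _ => by
      simp only [Pi.sub_apply, Pi.mul_apply]; push_cast; ring
  have hden : IsSemialgebraicFunOn ℚ T₀ fun t =>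
      1 + √(1 - (m : ℝ) * ((yb (t 0) - Polynomial.aeval (t 0) Y₀) / vS H (t 0)) ^ 2) :=
    ((isSemialgebraicFunOn_ratCast hT₀ 1).add_holds (IsSemialgebraicFunOn.sqrt_holds hin)).congr
      fun t _ => by simp only [Pi.add_apply]; push_cast; ring
  exact (hr.div hden fun t _ => (one_add_sqrt_pos m _).ne').congr fun t _ => by simp only [gV]
where
  /-- one-variable version of `aeval_polyX` -/
  aeval_polyX₁ (t : Fin 1 → ℝ) (P : Polynomial ℚ) :
      aeval t (Polynomial.aeval (X 0 : MvPolynomial (Fin 1) ℚ) P) = Polynomial.aeval (t 0) P := by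
    rw [← Polynomial.aeval_algHom_apply, MvPolynomial.aeval_X]

/-- **Edge pull-back (rule (2) in one variable along `v = V_m(r(x))`).**  Let `r'` be a boundary
term of `vband_move` living on the `v`-line, whose integrand at `v = v_b(x)` is `F(x, v_b(x))`
(this says that the edge is `x = u(v)` with `u(v_b(x)) = x`), and let `T₀` be an `x`-piece on which
`y_b` is semialgebraic and differentiable, `H > 0`, `m r² < 1`, and `r = (y_b − Y₀)/√H` is
injective, with `v_b(T₀) ⊇ r'.domain`.  Then `[r'] ≡ [T, γ·Hi(x)·t_b(x)·|N_b(x)|/(2H(x)²)]` for the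
pulled-back piece `T ⊆ T₀` — an `m`-FREE one-variable integrand with the single radical `t_b`.
[KontsevichZagier2001 §1.2 rule (2); this node gen 4 `exists_cov₁`] -/
theorem edge_pullback (hm : 0 ≤ m) (Hi : Polynomial ℚ) (γ : ℚ) (r' : KZ.IntegralRep 1)
    {T₀ : Set (Fin 1 → ℝ)} (hT₀ : IsSemialgebraic ℚ T₀) {yb yb' : ℝ → ℝ}
    (hybs : IsSemialgebraicFunOn ℚ T₀ fun t => yb (t 0))
    (hyb : ∀ t ∈ T₀, HasDerivAt yb (yb' (t 0)) (t 0))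
    (hH : ∀ t ∈ T₀, 0 < Polynomial.aeval (t 0) H)
    (hrx : ∀ t ∈ T₀, (m : ℝ) * ((yb (t 0) - Polynomial.aeval (t 0) Y₀) / vS H (t 0)) ^ 2 < 1)
    (hinj : ∀ s ∈ T₀, ∀ t ∈ T₀, (yb (s 0) - Polynomial.aeval (s 0) Y₀) / vS H (s 0) =
      (yb (t 0) - Polynomial.aeval (t 0) Y₀) / vS H (t 0) → s 0 = t 0)
    (hsurj : ∀ w ∈ r'.domain, ∃ t ∈ T₀, gV m ((yb (t 0) - Polynomial.aeval (t 0) Y₀) / vS H (t 0)) = w 0)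
    (hRe : ∀ t ∈ T₀, lift₁ (fun x => gV m ((yb x - Polynomial.aeval x Y₀) / vS H x)) t ∈ r'.domain →
      r'.integrand (lift₁ (fun x => gV m ((yb x - Polynomial.aeval x Y₀) / vS H x)) t) =
        vF m Hi γ (t 0) (gV m ((yb (t 0) - Polynomial.aeval (t 0) Y₀) / vS H (t 0))))
    (R : (Fin 1 → ℝ) → ℝ) (hR : IsSemialgebraicFunOn ℚ T₀ R)
    (hRE : ∀ t ∈ T₀, R t = (γ : ℝ) * Polynomial.aeval (t 0) Hi *
        (vS H (t 0) * gT m (gV m ((yb (t 0) - Polynomial.aeval (t 0) Y₀) / vS H (t 0)))) *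
        (|2 * Polynomial.aeval (t 0) H * (yb' (t 0) - Polynomial.aeval (t 0) (Polynomial.derivative Y₀)) -
            (yb (t 0) - Polynomial.aeval (t 0) Y₀) * Polynomial.aeval (t 0) (Polynomial.derivative H)| /
          (2 * Polynomial.aeval (t 0) H ^ 2))) :
    ∃ r : KZ.IntegralRep 1,
      r.domain = {t | t ∈ T₀ ∧
        lift₁ (fun x => gV m ((yb x - Polynomial.aeval x Y₀) / vS H x)) t ∈ r'.domain} ∧
      r.integrand = R ∧ KZ.of r - KZ.of r' ∈ KZ.relations := by
  refine exists_cov₁ r' hT₀ (fun x => gV m ((yb x - Polynomial.aeval x Y₀) / vS H x))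
    (fun x => deriv (fun s => gV m ((yb s - Polynomial.aeval s Y₀) / vS H s)) x)
    (isSemialgebraicFunOn_gV_ratio m hT₀ hybs hH) (fun t ht => ?_) (fun s hs t ht hst => ?_) hsurj R hR
    fun t ht _ => ?_
  · exact (((differentiableAt_gV (hrx t ht)).comp (t 0)
      (hasDerivAt_ratio (Y₀ := Y₀) (hyb t ht) (hH t ht)).differentiableAt)).hasDerivAt
  · exact hinj s hs t ht (gV_inj (hrx s hs).le (hrx t ht).le hst)
  · rw [hRE t ht, hRe t ht ‹_›, edge_term_abs hm (hyb t ht) (hH t ht) (hrx t ht) Hi γ]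

end Summit.KontsevichZagierPeriods.RootDecompWalshStrata.ConicDescent.VertexChart
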